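import Literature.AlgebraicGeometry.Resolution.LogChartFaceSplitting
import HarnessLib

/-!
# Reduction of a log regular chart to its sharp form at a prime (Kato 1994, (2.1), (3.2), (10.3))

`Literature/AlgebraicGeometry/Resolution/LogChartSharpReduction.lean`. K. Kato, *Toric
singularities*, Amer. J. Math. 116 (1994): at a point `x = 𝔭` of a chart `φ : P → A` (`P ⊆ ℤⁿ`
fs) one replaces `P` by the sharp monoid `P̄ = P_F/F^{gp}` (`F = φ⁻¹(A ∖ 𝔭)` the face at `𝔭`)
and `φ` by the induced `φ̄ : P̄ → A_𝔭` ("we may assume `φ⁻¹(𝒪^×) = P^×`", proofs of (3.2),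
(8.3), (10.3)). With the splitting `π` of `LogChartFaceSplitting.lean` (`P̄ = π(P) ⊆ ℤⁿ`) this
file constructs `φ̄` and shows that Kato's log regularity `LogChart.IsLogRegularAt P φ 𝔭`
yields the "d-form" data used by the `LogRegularRefinement*` files over `A_𝔭`:

* `faceMonoid` — the face `F_𝔭` as a submonoid of `ℤⁿ`, `isFaceOf_faceMonoid`;
* `val` — the chart as a function on `ℤⁿ` (`= 1` off `P`);
* `sharpChart π` — `φ̄ : ℤⁿ → A_𝔭`, `φ̄(p − f) = φ(p) φ(f)⁻¹` on `P − F ⊇ π(P)`; multiplicative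
  on `π(P)`, `φ̄(π(P) ∖ 0) ⊆ 𝔪`, and `(φ̄(π(P) ∖ 0)) = I(𝔭) A_𝔭` (`span_sharpChart_eq`);
* `exists_dform_of_isLogRegularAt` — `∃ t₁..t_d ∈ 𝔪_{A_𝔭}` with `𝔪 = (φ̄(P̄ ∖ 0)) + (t)` and
  `dim A_𝔭 = d + (n − rk F^{gp})`.

References: [Kato1994] K. Kato, Toric singularities, Amer. J. Math. 116 (1994), (1.5)–(1.6),
Def. (2.1), (3.2), (10.3).
-/

noncomputable section

open IsLocalRing

namespace Literature.AlgebraicGeometry.Resolution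

namespace LogChart

universe u

variable {n : ℕ} {A : Type u} [CommRing A] (P : AddSubmonoid (Fin n → ℤ))
  (φ : Multiplicative P →* A) (𝔭 : Ideal A)

/-! ### The chart as a function on `ℤⁿ`; the face at `𝔭` -/

open Classical in
/-- The chart as a function on `ℤⁿ`, extended by `1` off `P`. [cite: Kato1994, (1.5)] -/
def val (v : Fin n → ℤ) : A :=
  if h : v ∈ P then φ (Multiplicative.ofAdd ⟨v, h⟩) else 1

/-- `val` on elements of `P`. [cite: Kato1994, (1.5)] -/
theorem val_of_mem {v : Fin n → ℤ} (h : v ∈ P) : val P φ v = φ (Multiplicative.ofAdd ⟨v, h⟩) := by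
  unfold val; rw [dif_pos h]

/-- `val 0 = 1`. [cite: Kato1994, (1.5)] -/
theorem val_zero : val P φ 0 = 1 := by
  rw [val_of_mem P φ P.zero_mem]
  exact map_one φ

/-- `val` is multiplicative on `P`. [cite: Kato1994, (1.5)] -/
theorem val_add {a b : Fin n → ℤ} (ha : a ∈ P) (hb : b ∈ P) :
    val P φ (a + b) = val P φ a * val P φ b := by
  rw [val_of_mem P φ (P.add_mem ha hb), val_of_mem P φ ha, val_of_mem P φ hb, ← map_mul]
  rfl

variable [𝔭.IsPrime]

/-- **The face at `𝔭`** as a submonoid of `ℤⁿ`: elements of `P` whose chart value is outside `𝔭`.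
[cite: Kato1994, Def. (2.1)] -/
def faceMonoid : AddSubmonoid (Fin n → ℤ) where
  carrier := {v | v ∈ P ∧ val P φ v ∉ 𝔭}
  zero_mem' := ⟨P.zero_mem, by rw [val_zero]; exact fun h => Ideal.IsPrime.ne_top' (Ideal.eq_top_of_isUnit_mem _ h isUnit_one)⟩
  add_mem' := by
    rintro a b ⟨ha, ha'⟩ ⟨hb, hb'⟩
    refine ⟨P.add_mem ha hb, ?_⟩
    rw [val_add P φ ha hb]
    exact fun h => (Ideal.IsPrime.mem_or_mem ‹_› h).elim ha' hb'

/-- Membership in the face. [cite: Kato1994, Def. (2.1)] -/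
@[simp] theorem mem_faceMonoid {v : Fin n → ℤ} : v ∈ faceMonoid P φ 𝔭 ↔ v ∈ P ∧ val P φ v ∉ 𝔭 :=
  Iff.rfl

/-- The face at `𝔭` is a face of `P`. [cite: Kato1994, (5.1)] -/
theorem isFaceOf_faceMonoid : IsFaceOf (faceMonoid P φ 𝔭) P where
  le := fun _ hv => hv.1
  mem_of_add_mem := by
    intro a ha b hb hab
    refine ⟨ha, fun h => hab.2 ?_⟩
    rw [val_add P φ ha hb]
    exact Ideal.mul_mem_right _ _ h

/-- The face, as a subset of `P`, is Kato's `face P φ 𝔭`; so the spans agree.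
[cite: Kato1994, Def. (2.1)] -/
theorem coe_image_face_eq : ((fun p : P => (p : Fin n → ℤ)) '' face P φ 𝔭) = (faceMonoid P φ 𝔭 : Set (Fin n → ℤ)) := by
  ext v
  simp only [Set.mem_image, mem_face_iff, SetLike.mem_coe, mem_faceMonoid]
  constructor
  · rintro ⟨⟨w, hw⟩, h, rfl⟩
    exact ⟨hw, by rw [val_of_mem P φ hw]; exact h⟩
  · rintro ⟨hv, h⟩
    exact ⟨⟨v, hv⟩, by rw [val_of_mem P φ hv] at h; exact h, rfl⟩

/-! ### The sharp chart `φ̄` on `P − F` -/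

/-- Chart values of face elements are units of `A_𝔭`. [cite: Kato1994, Def. (2.1)] -/
theorem isUnit_algebraMap_val {f : Fin n → ℤ} (hf : f ∈ faceMonoid P φ 𝔭) :
    IsUnit (algebraMap A (Localization.AtPrime 𝔭) (val P φ f)) :=
  IsLocalization.map_units (Localization.AtPrime 𝔭) ⟨val P φ f, show val P φ f ∈ 𝔭.primeCompl from hf.2⟩

open Classical in
/-- **The sharp chart** `φ̄ : ℤⁿ → A_𝔭`: on `P − F`, `φ̄(p − f) = φ(p)·φ(f)⁻¹`; `1` elsewhere.
[cite: Kato1994, (3.2)] -/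
def sharpChart (v : Fin n → ℤ) : Localization.AtPrime 𝔭 :=
  if h : ∃ pf : (Fin n → ℤ) × (Fin n → ℤ), pf.1 ∈ P ∧ pf.2 ∈ faceMonoid P φ 𝔭 ∧ v = pf.1 - pf.2 then
    algebraMap A (Localization.AtPrime 𝔭) (val P φ h.choose.1) *
      ↑(isUnit_algebraMap_val P φ 𝔭 h.choose_spec.2.1).unit⁻¹
  else 1

/-- **Well-definedness of `φ̄`**: `φ̄(v)·φ(f) = φ(p)` for ANY presentation `v = p − f`.
[cite: Kato1994, (3.2)] -/
theorem sharpChart_mul_of_eq_sub {v p f : Fin n → ℤ} (hp : p ∈ P) (hf : f ∈ faceMonoid P φ 𝔭)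
    (hv : v = p - f) :
    sharpChart P φ 𝔭 v * algebraMap A (Localization.AtPrime 𝔭) (val P φ f) =
      algebraMap A (Localization.AtPrime 𝔭) (val P φ p) := by
  classical
  have hex : ∃ pf : (Fin n → ℤ) × (Fin n → ℤ), pf.1 ∈ P ∧ pf.2 ∈ faceMonoid P φ 𝔭 ∧ v = pf.1 - pf.2 :=
    ⟨(p, f), hp, hf, hv⟩
  unfold sharpChart
  rw [dif_pos hex]
  set q := hex.choose with hq
  have hq1 : q.1 ∈ P := hex.choose_spec.1
  have hq2 : q.2 ∈ faceMonoid P φ 𝔭 := hex.choose_spec.2.1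
  have hq3 : v = q.1 - q.2 := hex.choose_spec.2.2
  -- `q.1 + f = p + q.2` in `P`
  have hsum : q.1 + f = p + q.2 := by
    have : q.1 - q.2 = p - f := hq3 ▸ hv.symm ▸ rfl
    linear_combination this
  have hval : val P φ q.1 * val P φ f = val P φ p * val P φ q.2 := by
    rw [← val_add P φ hq1 hf.1, ← val_add P φ hp hq2.1, hsum]
  have hu := isUnit_algebraMap_val P φ 𝔭 hq2
  calc algebraMap A (Localization.AtPrime 𝔭) (val P φ q.1) * ↑hu.unit⁻¹ *
        algebraMap A (Localization.AtPrime 𝔭) (val P φ f)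
      = algebraMap A (Localization.AtPrime 𝔭) (val P φ q.1 * val P φ f) * ↑hu.unit⁻¹ := by
        rw [map_mul]; ring
    _ = algebraMap A (Localization.AtPrime 𝔭) (val P φ p) *
        (algebraMap A (Localization.AtPrime 𝔭) (val P φ q.2) * ↑hu.unit⁻¹) := by
        rw [hval, map_mul]; ring
    _ = algebraMap A (Localization.AtPrime 𝔭) (val P φ p) := by rw [IsUnit.mul_val_inv, mul_one]

/-- `φ̄(v) = φ(p)·φ(f)⁻¹` for any presentation `v = p − f`. [cite: Kato1994, (3.2)] -/
theorem sharpChart_eq_of_eq_sub {v p f : Fin n → ℤ} (hp : p ∈ P) (hf : f ∈ faceMonoid P φ 𝔭)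
    (hv : v = p - f) :
    sharpChart P φ 𝔭 v = algebraMap A (Localization.AtPrime 𝔭) (val P φ p) *
      ↑(isUnit_algebraMap_val P φ 𝔭 hf).unit⁻¹ := by
  rw [← sharpChart_mul_of_eq_sub P φ 𝔭 hp hf hv, mul_assoc, IsUnit.mul_val_inv, mul_one]

/-- `φ̄` extends `φ` on `P`. [cite: Kato1994, (3.2)] -/
theorem sharpChart_of_mem {p : Fin n → ℤ} (hp : p ∈ P) :
    sharpChart P φ 𝔭 p = algebraMap A (Localization.AtPrime 𝔭) (val P φ p) := by
  rw [← sharpChart_mul_of_eq_sub P φ 𝔭 hp (faceMonoid P φ 𝔭).zero_mem (sub_zero p).symm, val_zero,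
    map_one, mul_one]

/-- `φ̄ 0 = 1`. [cite: Kato1994, (3.2)] -/
theorem sharpChart_zero : sharpChart P φ 𝔭 0 = 1 := by
  rw [sharpChart_of_mem P φ 𝔭 P.zero_mem, val_zero, map_one]

/-- `φ̄` is multiplicative on `P − F`. [cite: Kato1994, (3.2)] -/
theorem sharpChart_add {v w p q f g : Fin n → ℤ} (hp : p ∈ P) (hf : f ∈ faceMonoid P φ 𝔭)
    (hv : v = p - f) (hq : q ∈ P) (hg : g ∈ faceMonoid P φ 𝔭) (hw : w = q - g) :
    sharpChart P φ 𝔭 (v + w) = sharpChart P φ 𝔭 v * sharpChart P φ 𝔭 w := by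
  have hvw : v + w = (p + q) - (f + g) := by rw [hv, hw]; abel
  rw [sharpChart_eq_of_eq_sub P φ 𝔭 (P.add_mem hp hq) ((faceMonoid P φ 𝔭).add_mem hf hg) hvw,
    sharpChart_eq_of_eq_sub P φ 𝔭 hp hf hv, sharpChart_eq_of_eq_sub P φ 𝔭 hq hg hw]
  have hu := isUnit_algebraMap_val P φ 𝔭 ((faceMonoid P φ 𝔭).add_mem hf hg)
  have huf := isUnit_algebraMap_val P φ 𝔭 hf
  have hug := isUnit_algebraMap_val P φ 𝔭 hg
  -- compare after multiplying by the unit `φ(f+g) = φ f φ g`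
  have key : (↑hu.unit⁻¹ : Localization.AtPrime 𝔭) = ↑huf.unit⁻¹ * ↑hug.unit⁻¹ := by
    rw [← Units.val_mul, ← mul_inv]
    congr 2
    ext
    rw [Units.val_mul, IsUnit.unit_spec, IsUnit.unit_spec, IsUnit.unit_spec, val_add P φ hf.1 hg.1,
      map_mul]
  rw [key, val_add P φ hp hq, map_mul]
  ring

/-! ### `φ̄` on the sharp monoid `P̄ = π(P)` -/

section Proj

variable {P φ 𝔭}
variable {π : (Fin n → ℤ) →ₗ[ℤ] (Fin n → ℤ)}
  (hπ0 : ∀ v ∈ Submodule.span ℤ (faceMonoid P φ 𝔭 : Set (Fin n → ℤ)), π v = 0)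
  (hπ1 : ∀ v, v - π v ∈ Submodule.span ℤ (faceMonoid P φ 𝔭 : Set (Fin n → ℤ)))

include hπ1 in
/-- Every `π p`, `p ∈ P`, has a presentation `π p = (p + f₂) − f₁` with `f₁, f₂ ∈ F`.
[cite: Kato1994, (3.2)] -/
theorem exists_presentation_proj (p : Fin n → ℤ) :
    ∃ f₁ ∈ faceMonoid P φ 𝔭, ∃ f₂ ∈ faceMonoid P φ 𝔭, π p = (p + f₂) - f₁ := by
  obtain ⟨a, ha, b, hb, hab⟩ := (mem_span_int_iff_exists_sub _).1 (hπ1 p)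
  refine ⟨a, ha, b, hb, ?_⟩
  have : π p = p - (p - π p) := (sub_sub_cancel p (π p)).symm
  rw [this, hab]; abel

include hπ1 in
/-- `φ̄` is multiplicative on `π(P)`. [cite: Kato1994, (3.2)] -/
theorem sharpChart_proj_add {p q : Fin n → ℤ} (hp : p ∈ P) (hq : q ∈ P) :
    sharpChart P φ 𝔭 (π p + π q) = sharpChart P φ 𝔭 (π p) * sharpChart P φ 𝔭 (π q) := by
  obtain ⟨f₁, hf₁, f₂, hf₂, h1⟩ := exists_presentation_proj hπ1 p
  obtain ⟨g₁, hg₁, g₂, hg₂, h2⟩ := exists_presentation_proj hπ1 q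
  exact sharpChart_add P φ 𝔭 (P.add_mem hp hf₂.1) hf₁ h1 (P.add_mem hq hg₂.1) hg₁ h2

include hπ0 hπ1 in
/-- `φ̄` sends `π(P) ∖ 0` into `𝔪_{A_𝔭}`. [cite: Kato1994, (3.2)] -/
theorem sharpChart_proj_mem_maximalIdeal {p : Fin n → ℤ} (hp : p ∈ P) (hp0 : π p ≠ 0) :
    sharpChart P φ 𝔭 (π p) ∈ maximalIdeal (Localization.AtPrime 𝔭) := by
  obtain ⟨f₁, hf₁, f₂, hf₂, h1⟩ := exists_presentation_proj hπ1 p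
  rw [sharpChart_eq_of_eq_sub P φ 𝔭 (P.add_mem hp hf₂.1) hf₁ h1]
  refine Ideal.mul_mem_right _ _ ?_
  -- `p + f₂ ∉ F` (else `π p = π (p + f₂) = 0`), so `φ(p + f₂) ∈ 𝔭`
  have hnot : p + f₂ ∉ faceMonoid P φ 𝔭 := by
    intro hmem
    apply hp0
    have h2 : π (p + f₂) = 0 := hπ0 _ (Submodule.subset_span hmem)
    have h3 : π f₂ = 0 := hπ0 _ (Submodule.subset_span hf₂)
    have h4 : π (p + f₂) = π p + π f₂ := map_add π p f₂
    rw [h4, h3, add_zero] at h2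
    exact h2
  have hmem𝔭 : val P φ (p + f₂) ∈ 𝔭 := by
    by_contra hc
    exact hnot ⟨P.add_mem hp hf₂.1, hc⟩
  rw [← Localization.AtPrime.map_eq_maximalIdeal]
  exact Ideal.mem_map_of_mem _ hmem𝔭

include hπ0 hπ1 in
/-- **`(φ̄(P̄ ∖ 0)) = I(𝔭) A_𝔭`**: the sharp chart generates Kato's ideal after localisation.
[cite: Kato1994, Def. (2.1)] -/
theorem span_sharpChart_eq (h : IsFaceOf (faceMonoid P φ 𝔭) P) :
    Ideal.span (sharpChart P φ 𝔭 '' {w | w ∈ P.map π.toAddMonoidHom ∧ w ≠ 0}) =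
      (ideal P φ 𝔭).map (algebraMap A (Localization.AtPrime 𝔭)) := by
  refine le_antisymm (Ideal.span_le.2 ?_) ?_
  · rintro _ ⟨w, ⟨⟨p, hp, rfl⟩, hw0⟩, rfl⟩
    change sharpChart P φ 𝔭 (π p) ∈ _
    obtain ⟨f₁, hf₁, f₂, hf₂, h1⟩ := exists_presentation_proj hπ1 p
    rw [sharpChart_eq_of_eq_sub P φ 𝔭 (P.add_mem hp hf₂.1) hf₁ h1]
    refine Ideal.mul_mem_right _ _ (Ideal.mem_map_of_mem _ (Ideal.subset_span ?_))
    have hnot : val P φ (p + f₂) ∈ 𝔭 := by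
      by_contra hc
      apply hw0
      change π p = 0
      have h2 : π (p + f₂) = 0 := hπ0 _ (Submodule.subset_span ⟨P.add_mem hp hf₂.1, hc⟩)
      have h3 : π f₂ = 0 := hπ0 _ (Submodule.subset_span hf₂)
      have h4 : π (p + f₂) = π p + π f₂ := map_add π p f₂
      rw [h4, h3, add_zero] at h2
      exact h2
    refine ⟨⟨p + f₂, P.add_mem hp hf₂.1⟩, ?_, ?_⟩
    · show φ (Multiplicative.ofAdd ⟨p + f₂, _⟩) ∈ 𝔭
      rw [← val_of_mem P φ (P.add_mem hp hf₂.1)]; exact hnot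
    · exact (val_of_mem P φ (P.add_mem hp hf₂.1)).symm
  · rw [Ideal.map_le_iff_le_comap]
    unfold ideal
    refine Ideal.span_le.2 ?_
    rintro _ ⟨⟨p, hp⟩, hp𝔭, rfl⟩
    rw [SetLike.mem_coe, Ideal.mem_comap]
    change φ (Multiplicative.ofAdd ⟨p, hp⟩) ∈ 𝔭 at hp𝔭
    change algebraMap A (Localization.AtPrime 𝔭) (φ (Multiplicative.ofAdd ⟨p, hp⟩)) ∈ _
    rw [← val_of_mem P φ hp] at hp𝔭 ⊢
    -- `π p ≠ 0` since `p ∉ F`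
    have hπp0 : π p ≠ 0 := by
      intro h0
      have hpF : p ∈ faceMonoid P φ 𝔭 := (h.proj_eq_zero_iff hπ0 hπ1 hp).1 h0
      exact hpF.2 hp𝔭
    -- `φ(p) = φ̄(π p) · φ(f₁) · φ(f₂)⁻¹`
    obtain ⟨f₁, hf₁, f₂, hf₂, h1⟩ := exists_presentation_proj hπ1 p
    have hmul := sharpChart_mul_of_eq_sub P φ 𝔭 (P.add_mem hp hf₂.1) hf₁ h1
    rw [val_add P φ hp hf₂.1, map_mul] at hmul
    have hu₂ := isUnit_algebraMap_val P φ 𝔭 hf₂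
    have heq : algebraMap A (Localization.AtPrime 𝔭) (val P φ p) =
        sharpChart P φ 𝔭 (π p) * algebraMap A (Localization.AtPrime 𝔭) (val P φ f₁) * ↑hu₂.unit⁻¹ := by
      rw [hmul, mul_assoc, IsUnit.mul_val_inv, mul_one]
    rw [heq]
    refine Ideal.mul_mem_right _ _ (Ideal.mul_mem_right _ _ (Ideal.subset_span ?_))
    exact ⟨π p, ⟨⟨p, hp, rfl⟩, hπp0⟩, rfl⟩

end Proj

/-! ### The d-form data from log regularity -/

omit [𝔭.IsPrime] in
/-- **Log regularity at `𝔭` in d-form.** If the chart is log regular at `𝔭` (Kato (2.1)) then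
there are `t₁, …, t_d ∈ 𝔪_{A_𝔭}`, `d = dim A_𝔭/I(𝔭)A_𝔭`, with `𝔪_{A_𝔭} = I(𝔭)A_𝔭 + (t)` and
`dim A_𝔭 = d + (n − rk F_𝔭^{gp})` (lift a regular system of parameters of the regular local ring
`A_𝔭/I(𝔭)A_𝔭`). [cite: Kato1994, Def. (2.1)] -/
theorem exists_dform_of_isLogRegularAt [𝔭.IsPrime] (hreg : IsLogRegularAt P φ 𝔭) :
    ∃ (d : ℕ) (t : Fin d → Localization.AtPrime 𝔭),
      (∀ k, t k ∈ maximalIdeal (Localization.AtPrime 𝔭)) ∧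
      maximalIdeal (Localization.AtPrime 𝔭) ≤
        (ideal P φ 𝔭).map (algebraMap A (Localization.AtPrime 𝔭)) ⊔ Ideal.span (Set.range t) ∧
      ringKrullDim (Localization.AtPrime 𝔭) =
        ((d + (n - Module.finrank ℤ (Submodule.span ℤ (faceMonoid P φ 𝔭 : Set (Fin n → ℤ)))) : ℕ) :
          WithBot ℕ∞) := by
  classical
  obtain ⟨hR, hdim⟩ := hreg
  set I' := (ideal P φ 𝔭).map (algebraMap A (Localization.AtPrime 𝔭)) with hI'
  haveI := hR
  -- generators of the maximal ideal of the regular local ring `A_𝔭/I'`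
  have hfg : (maximalIdeal (Localization.AtPrime 𝔭 ⧸ I')).FG :=
    (maximalIdeal _).fg_of_isNoetherianRing
  obtain ⟨s, hscard, hsspan⟩ := Submodule.FG.exists_span_finset_card_eq_spanFinrank hfg
  have hlift : ∀ y : Localization.AtPrime 𝔭 ⧸ I', ∃ x : Localization.AtPrime 𝔭,
      Ideal.Quotient.mk I' x = y := Ideal.Quotient.mk_surjective
  choose lift hlift using hlift
  let t : Fin s.card → Localization.AtPrime 𝔭 := fun i => lift (s.equivFin.symm i : _)
  have hys : ∀ i, ((s.equivFin.symm i : Localization.AtPrime 𝔭 ⧸ I')) ∈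
      maximalIdeal (Localization.AtPrime 𝔭 ⧸ I') := fun i => by
    rw [← hsspan]; exact Submodule.subset_span (s.equivFin.symm i).2
  refine ⟨s.card, t, fun i => ?_, ?_, ?_⟩
  · -- lifts of non-units are non-units
    rw [mem_maximalIdeal, mem_nonunits_iff]
    intro hu
    have := (hys i)
    rw [mem_maximalIdeal, mem_nonunits_iff] at this
    apply this
    rw [← hlift (s.equivFin.symm i : _)]
    exact hu.map _
  · intro x hx
    have hx' : Ideal.Quotient.mk I' x ∈ maximalIdeal (Localization.AtPrime 𝔭 ⧸ I') := by
      rw [← IsLocalRing.map_maximalIdeal_of_surjective (Ideal.Quotient.mk I')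
        Ideal.Quotient.mk_surjective]
      exact Ideal.mem_map_of_mem _ hx
    rw [← hsspan] at hx'
    -- `span s = (span t).map mk`
    have hmap : (Ideal.span (Set.range t)).map (Ideal.Quotient.mk I') =
        Submodule.span (Localization.AtPrime 𝔭 ⧸ I') (s : Set (Localization.AtPrime 𝔭 ⧸ I')) := by
      rw [Ideal.map_span, ← Set.range_comp]
      have hr : Set.range (⇑(Ideal.Quotient.mk I') ∘ t) = (s : Set _) := by
        ext y
        constructor
        · rintro ⟨i, rfl⟩
          simp only [Function.comp_apply, t, hlift]
          exact (s.equivFin.symm i).2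
        · intro hy
          exact ⟨s.equivFin ⟨y, hy⟩, by simp only [Function.comp_apply, t, hlift, Equiv.symm_apply_apply]⟩
      rw [hr]
    have hx'' : Ideal.Quotient.mk I' x ∈ (Ideal.span (Set.range t)).map (Ideal.Quotient.mk I') := by
      rw [hmap]; exact hx'
    rw [Ideal.mem_map_iff_of_surjective _ Ideal.Quotient.mk_surjective] at hx''
    obtain ⟨y, hy, hyx⟩ := hx''
    have hxy : x - y ∈ I' := by
      rw [← Ideal.Quotient.eq_zero_iff_mem, map_sub, hyx, sub_self]
    have : x = (x - y) + y := by ring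
    rw [this]
    exact Ideal.add_mem _ (Ideal.mem_sup_left hxy) (Ideal.mem_sup_right hy)
  · rw [hdim, coe_image_face_eq]
    have hreg' := (isRegularLocalRing_iff (Localization.AtPrime 𝔭 ⧸ I')).mp hR
    rw [← hreg', ← hscard]
    push_cast
    rfl

end LogChart

end Literature.AlgebraicGeometry.Resolution
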